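import Summits.Ventures.CertifiedArithmetic.Expansions.Orient2dEstimate
import Literature.ComputerArithmetic.Shewchuk1997.FastExpansionSum
import Mathlib.Tactic.Linarith
import Mathlib.Tactic.Positivity
import Mathlib.Tactic.Ring
import Mathlib.Tactic.FieldSimp
import Mathlib.Tactic.NormNum

/-!
# APPROXIMATE under round-to-even: the three quarters are attained in the limit

HONEST FRAMING. New work of this programme (Ventures), not a published result: two explicit
one-parameter families of expansions on which Shewchuk's APPROXIMATE (`estimate`: sum the
components smallest first in floating point, `predicates.c`'s `estimate()`), run with
round-to-nearest-EVEN at precision `p`, commits an absolute error as close to `(3/4)·u·2^s` as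
one likes (`u = 2^-p`, all components `< 2^s` in magnitude): no constant below `3/4` bounds
`|estimate l − Σ l|/(u·2^s)` uniformly in `p` (`three_quarters_le_of_uniform_bound`). The matching
upper bound — `|estimate l − Σ l| < (3/4)·u·2^s` for EVERY nonoverlapping expansion under
round-to-even — is the business of the companion file `EstimateThreeQuarters` of this series
(staged behind `EstimateLastBit`, on whose last-bit theorem it rests); nothing below depends on it.

THE FAMILIES (precision `p ≥ 3`, any exponent floor `emin ≤ 0`, `s = 2p + 2`, `u·2^s = 2^(p+2)`).
* STRONGLY NONOVERLAPPING ([Shewchuk1997] §2.4): `l = ⟨3·2^p − 4, 2^(2p), 2^(2p+1)⟩`.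
  `(3·2^p − 4) ⊕ 2^(2p) = 2^(2p) + 2^(p+1)` (nearest float; error `2^p − 4`, downward), then
  `(2^(2p) + 2^(p+1)) ⊕ 2^(2p+1) = 3·2^(2p)`: the argument `3·2^(2p) + 2^(p+1)` is the midpoint
  of the consecutive floats `3·2^(2p)`, `3·2^(2p) + 2^(p+2)` and round-to-even takes the even
  significand (error `2^(p+1)`, downward again). `Σ l = 3·2^(2p) + 3·2^p − 4`, so
  `|estimate l − Σ l| = 3·2^p − 4 = (3/4 − u)·u·2^s` (`estimate_roundTiesEven_strong_family`).
* NONOVERLAPPING ([Shewchuk1997] §2.1; the top pair is adjacent, so not strongly nonoverlapping):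
  `l = ⟨2^p − 1, 2^(2p) + 2^(p+1), 2^(2p+1)⟩`, same second step, first step exact but for
  `2^p − 1`: `|estimate l − Σ l| = 3·2^p − 1 = (3/4 − u/4)·u·2^s` (`estimate_roundTiesEven_family`).
Smallest instances (`p = 3`, `u·2^s = 32`): `⟨20, 64, 128⟩ ↦ 192 = Σ − 20` and `⟨7, 80, 128⟩
↦ 192 = Σ − 23`; binary64: `⟨3·2^53 − 4, 2^106, 2^107⟩ ↦ 3·2^106 = Σ − (3·2^53 − 4)`, an error
of `(3/4 − 2^-53)·2^55` (`estimate_roundTiesEven_binary64`).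

WHY THESE SHAPES. An error near `(3/4)·u·2^s` needs a last addition that is a tie in the top
binade (roundoff `u·2^s/2`, the most a single rounding gives) over a running word that already
carries an error near `u·2^s/4` — which, by the last-bit theorem of `EstimateLastBit` (the error
is below half the word's lowest set bit), requires the word to be odd at the scale `u·2^s/2`.
Both families realise this with the word `2^(2p) + 2^(p+1)` (inherited error `2^p − 4` resp.
`2^p − 1`, just below `2^p = u·2^s/4`), the tie then breaking downward to the even neighbour.
At fixed small `p` longer expansions do slightly better than `3/4 − u/4`: exhaustive enumeration
under round-to-even (seat folder `work/rne/check_hinfN.c`, nonoverlapping lists of `≤ 7` floats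
below `2^13`) finds the maxima `0.7139, 0.7324, 0.7383, 0.7422` of `|estimate − Σ|/(u·2^s)` for
`p = 2, 3, 4, 5`, all below `3/4`; the supremum at fixed `p` is not determined here.

References: J. R. Shewchuk, Discrete Comput. Geom. 18 (1997) 305–363, §2.1, §2.4 (Fig. 14),
§2.7 APPROXIMATE, `predicates.c` `estimate()` [Shewchuk1997]; round-to-even is
`Literature/…/BoldoJeannerodMelquiondMuller2023/RoundToNearestEven.lean`.
-/

namespace Summit.Ventures.CertifiedArithmetic.Expansions

open Literature.ComputerArithmetic.JeannerodRump2018 (IsFloat IsRoundNearest unitRoundoff)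
open Literature.ComputerArithmetic.BoldoJeannerodMelquiondMuller2023 (roundTiesEven ulp
  ulp_of_ne_zero isRoundNearest_roundTiesEven roundTiesEven_of_tie fl_eq_of_abs_sub_lt_half_ulp)
open Literature.ComputerArithmetic.Shewchuk1997

/-! ### The two roundings, precision `p = j + 3` (`2^p = 8·2^j`, `2^(2p) = 64·2^j·2^j`) -/

/-- `ulp = 2^(p+1) = 16·2^j` on the binade `[2^(2p), 2^(2p+1))` and `ulp = 2^(p+2) = 32·2^j`
on `[2^(2p+1), 2^(2p+2))` (`emin ≤ 0`). -/
theorem threeQuarters_ulp (j : ℕ) {emin : ℤ} (hemin : emin ≤ 0) (x : ℚ) :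
    (64 * (2 ^ j * 2 ^ j) ≤ x → x < 128 * (2 ^ j * 2 ^ j) → ulp (j + 3) emin x = 16 * 2 ^ j) ∧
    (128 * (2 ^ j * 2 ^ j) ≤ x → x < 256 * (2 ^ j * 2 ^ j) →
      ulp (j + 3) emin x = 32 * 2 ^ j) := by
  have h2 : (2 : ℚ) ≠ 0 := by norm_num
  have hzj : ∀ k : ℕ, ((2 : ℕ) : ℚ) ^ ((j : ℤ) + j + k) = 2 ^ k * (2 ^ j * 2 ^ j) := by
    intro k
    rw [Nat.cast_ofNat, zpow_add₀ h2, zpow_add₀ h2, zpow_natCast, zpow_natCast]; ring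
  have key : ∀ (k : ℕ) (x : ℚ), 2 ^ (6 + k) * (2 ^ j * 2 ^ j) ≤ x →
      x < 2 ^ (6 + k + 1) * (2 ^ j * 2 ^ j) → ulp (j + 3) emin x = 2 ^ (4 + k) * 2 ^ j := by
    intro k x hlo hhi
    have hxpos : 0 < x := lt_of_lt_of_le (by positivity) hlo
    have hx0 : x ≠ 0 := hxpos.ne'
    have hpos : 0 < |x| := abs_pos.mpr hx0
    have habs : |x| = x := abs_of_pos hxpos
    have hlog : Int.log 2 |x| = (j : ℤ) + j + (6 + k : ℕ) := by
      apply le_antisymm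
      · have hlt : |x| < ((2 : ℕ) : ℚ) ^ ((j : ℤ) + j + (6 + k : ℕ) + 1) := by
          rw [show (j : ℤ) + j + (6 + k : ℕ) + 1 = (j : ℤ) + j + (6 + k + 1 : ℕ) by
            push_cast; ring, hzj, habs]
          exact hhi
        have := (Int.lt_zpow_iff_log_lt (b := 2) (by norm_num) hpos).mp hlt
        omega
      · have hle : ((2 : ℕ) : ℚ) ^ ((j : ℤ) + j + (6 + k : ℕ)) ≤ |x| := by
          rw [hzj, habs]; exact hlo
        exact (Int.zpow_le_iff_le_log (b := 2) (by norm_num) hpos).mp hle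
    rw [ulp_of_ne_zero hx0, hlog]
    have : (j : ℤ) + j + (6 + k : ℕ) - ((j + 3 : ℕ) : ℤ) + 1 = (j : ℤ) + (4 + k : ℕ) := by
      push_cast; ring
    rw [this, max_eq_right (by omega), zpow_add₀ h2, zpow_natCast, zpow_natCast]; ring
  refine ⟨fun hlo hhi => ?_, fun hlo hhi => ?_⟩
  · rw [key 0 x (by norm_num; exact hlo) (by norm_num; exact hhi)]; norm_num
  · rw [key 1 x (by norm_num; exact hlo) (by norm_num; exact hhi)]; norm_num

/-- The running word `2^(2p) + 2^(p+1) = (2^(p−1) + 1)·2^(p+1)` is a float — ODD at the scale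
`2^(p+1)`, which is what lets it carry an error close to `2^p` (last-bit theorem). -/
theorem threeQuarters_isFloat_word (j : ℕ) {emin : ℤ} (hemin : emin ≤ 0) :
    IsFloat (j + 3) emin (64 * (2 ^ j * 2 ^ j) + 16 * 2 ^ j) := by
  have h1 : (1 : ℤ) ≤ 2 ^ j := one_le_pow₀ (by norm_num)
  refine ⟨4 * 2 ^ j + 1, (j : ℤ) + 4, ?_, by omega, ?_⟩
  · rw [show (2 : ℤ) ^ (j + 3) = 8 * 2 ^ j by ring, abs_of_pos (by positivity)]; linarith
  · rw [zpow_add₀ (by norm_num : (2 : ℚ) ≠ 0), zpow_natCast]; push_cast; ring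

/-- THE FIRST ROUNDING (not a tie). For `0 < r ≤ 2^p`:
`RNₑ(2^(2p) + 3·2^p − r) = 2^(2p) + 2^(p+1)` — the argument lies within `2^p − r < 2^p = ulp/2`
of that float (binade `[2^(2p), 2^(2p+1))`, `ulp = 2^(p+1)`); the error `2^p − r` is downward. -/
theorem threeQuarters_round₁ (j : ℕ) {emin : ℤ} (hemin : emin ≤ 0) {r : ℚ} (hr0 : 0 < r)
    (hr : r ≤ 8 * 2 ^ j) :
    roundTiesEven (j + 3) emin (64 * (2 ^ j * 2 ^ j) + 24 * 2 ^ j - r)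
      = 64 * (2 ^ j * 2 ^ j) + 16 * 2 ^ j := by
  have ht1 : (1 : ℚ) ≤ 2 ^ j := one_le_pow₀ (by norm_num)
  have hjj : (2 : ℚ) ^ j ≤ 2 ^ j * 2 ^ j := by nlinarith
  have hu := (threeQuarters_ulp j hemin (64 * (2 ^ j * 2 ^ j) + 24 * 2 ^ j - r)).1
    (by linarith) (by linarith)
  refine fl_eq_of_abs_sub_lt_half_ulp (p := j + 3) (by omega) (isRoundNearest_roundTiesEven
    (by omega)) (threeQuarters_isFloat_word j hemin) ?_
  rw [hu, show (64 * (2 ^ j * 2 ^ j) + 24 * 2 ^ j - r - (64 * (2 ^ j * 2 ^ j) + 16 * 2 ^ j) : ℚ)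
    = 8 * 2 ^ j - r by ring, abs_of_nonneg (by linarith)]
  linarith

/-- THE TIE. `RNₑ(3·2^(2p) + 2^(p+1)) = 3·2^(2p)`: the argument is the midpoint of the consecutive
floats `3·2^(2p) = (3·2^(p−1))·2^(p+2)` and `3·2^(2p) + 2^(p+2)` (binade `[2^(2p+1), 2^(2p+2))`,
`ulp = 2^(p+2)`), and `⌊·/ulp⌋ = 3·2^(p−1) = 6·2^j` is even: error `ulp/2`, downward. -/
theorem threeQuarters_round₂ (j : ℕ) {emin : ℤ} (hemin : emin ≤ 0) :
    roundTiesEven (j + 3) emin (192 * (2 ^ j * 2 ^ j) + 16 * 2 ^ j) = 192 * (2 ^ j * 2 ^ j) := by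
  have ht1 : (1 : ℚ) ≤ 2 ^ j := one_le_pow₀ (by norm_num)
  have hjj : (2 : ℚ) ^ j ≤ 2 ^ j * 2 ^ j := by nlinarith
  set y : ℚ := 192 * (2 ^ j * 2 ^ j) + 16 * 2 ^ j with hy
  have hu : ulp (j + 3) emin y = 32 * 2 ^ j :=
    (threeQuarters_ulp j hemin y).2 (by rw [hy]; linarith) (by rw [hy]; linarith)
  have hdiv : y / (32 * 2 ^ j) = 6 * 2 ^ j + 1 / 2 := by rw [hy]; field_simp; ring
  have hN : ⌊y / (32 * 2 ^ j)⌋ = 6 * 2 ^ j := by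
    rw [hdiv, Int.floor_eq_iff]; push_cast; constructor <;> linarith
  have htie : y - (⌊y / ulp (j + 3) emin y⌋ : ℚ) * ulp (j + 3) emin y =
      ((⌊y / ulp (j + 3) emin y⌋ : ℚ) + 1) * ulp (j + 3) emin y - y := by
    rw [hu, hN, hy]; push_cast; ring
  have heven : Even ⌊y / ulp (j + 3) emin y⌋ := by
    rw [hu, hN]; exact ⟨3 * 2 ^ j, by ring⟩
  rw [roundTiesEven_of_tie htie, if_pos heven, hu, hN]; push_cast; ring

/-- THE RUNS: `estimate ⟨3·2^p − r, 2^(2p), 2^(2p+1)⟩ = ((3·2^p − r) ⊕ 2^(2p)) ⊕ 2^(2p+1)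
= (2^(2p) + 2^(p+1)) ⊕ 2^(2p+1) = 3·2^(2p)` and likewise
`estimate ⟨2^p − r, 2^(2p) + 2^(p+1), 2^(2p+1)⟩ = 3·2^(2p)` (`0 < r ≤ 2^p`). -/
theorem threeQuarters_estimate (j : ℕ) {emin : ℤ} (hemin : emin ≤ 0) {r : ℚ} (hr0 : 0 < r)
    (hr : r ≤ 8 * 2 ^ j) :
    estimate (roundTiesEven (j + 3) emin)
        [24 * 2 ^ j - r, 64 * (2 ^ j * 2 ^ j), 128 * (2 ^ j * 2 ^ j)] = 192 * (2 ^ j * 2 ^ j) ∧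
    estimate (roundTiesEven (j + 3) emin)
        [8 * 2 ^ j - r, 64 * (2 ^ j * 2 ^ j) + 16 * 2 ^ j, 128 * (2 ^ j * 2 ^ j)]
      = 192 * (2 ^ j * 2 ^ j) := by
  have e₃ : ∀ a b c : ℚ, estimate (roundTiesEven (j + 3) emin) [a, b, c] =
      roundTiesEven (j + 3) emin (roundTiesEven (j + 3) emin (a + b) + c) := fun _ _ _ => rfl
  have h₂ : roundTiesEven (j + 3) emin (64 * (2 ^ j * 2 ^ j) + 16 * 2 ^ j + 128 * (2 ^ j * 2 ^ j))
      = 192 * (2 ^ j * 2 ^ j) := by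
    rw [show (64 * (2 ^ j * 2 ^ j) + 16 * 2 ^ j + 128 * (2 ^ j * 2 ^ j) : ℚ)
      = 192 * (2 ^ j * 2 ^ j) + 16 * 2 ^ j by ring]
    exact threeQuarters_round₂ j hemin
  refine ⟨?_, ?_⟩
  · rw [e₃, show (24 * 2 ^ j - r + 64 * (2 ^ j * 2 ^ j) : ℚ)
      = 64 * (2 ^ j * 2 ^ j) + 24 * 2 ^ j - r by ring, threeQuarters_round₁ j hemin hr0 hr, h₂]
  · rw [e₃, show (8 * 2 ^ j - r + (64 * (2 ^ j * 2 ^ j) + 16 * 2 ^ j) : ℚ)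
      = 64 * (2 ^ j * 2 ^ j) + 24 * 2 ^ j - r by ring, threeQuarters_round₁ j hemin hr0 hr, h₂]

/-! ### The expansions -/

/-- `⟨3·2^p − 4, 2^(2p), 2^(2p+1)⟩ = ⟨(3·2^(p−2) − 1)·2², 1·2^(2p), 1·2^(2p+1)⟩` and
`⟨2^p − 1, 2^(2p) + 2^(p+1), 2^(2p+1)⟩ = ⟨(2^p − 1)·2⁰, (2^(p−1) + 1)·2^(p+1), 1·2^(2p+1)⟩` are
lists of `p`-bit floats (`emin ≤ 0`). -/
theorem threeQuarters_isFloat (j : ℕ) {emin : ℤ} (hemin : emin ≤ 0) :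
    (∀ x ∈ [24 * 2 ^ j - 4, 64 * (2 ^ j * 2 ^ j), 128 * (2 ^ j * 2 ^ j)],
      IsFloat (j + 3) emin x) ∧
    (∀ x ∈ [8 * 2 ^ j - 1, 64 * (2 ^ j * 2 ^ j) + 16 * 2 ^ j, 128 * (2 ^ j * 2 ^ j)],
      IsFloat (j + 3) emin x) := by
  have h1 : (1 : ℤ) ≤ 2 ^ j := one_le_pow₀ (by norm_num)
  have h8 : (2 : ℤ) ^ (j + 3) = 8 * 2 ^ j := by ring
  have h2 : (2 : ℚ) ≠ 0 := by norm_num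
  have hbig : ∀ k : ℕ, IsFloat (j + 3) emin (2 ^ k * (2 ^ j * 2 ^ j)) := fun k =>
    ⟨1, (j : ℤ) + j + k, by rw [abs_one]; exact one_lt_pow₀ (by norm_num) (by omega), by omega,
      by rw [zpow_add₀ h2, zpow_add₀ h2, zpow_natCast, zpow_natCast]; push_cast; ring⟩
  have h64 := hbig 6
  have h128 := hbig 7
  norm_num at h64 h128
  refine ⟨fun x hx => ?_, fun x hx => ?_⟩ <;>
    simp only [List.mem_cons, List.not_mem_nil, or_false] at hx
  · rcases hx with rfl | rfl | rfl
    · refine ⟨6 * 2 ^ j - 1, 2, ?_, by omega, by rw [zpow_two]; push_cast; ring⟩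
      rw [h8, abs_of_pos (by linarith)]; linarith
    · exact h64
    · exact h128
  · rcases hx with rfl | rfl | rfl
    · refine ⟨8 * 2 ^ j - 1, 0, ?_, hemin, by rw [zpow_zero]; push_cast; ring⟩
      rw [h8, abs_of_pos (by linarith)]; linarith
    · exact threeQuarters_isFloat_word j hemin
    · exact h128

/-- **`⟨3·2^p − 4, 2^(2p), 2^(2p+1)⟩` IS STRONGLY NONOVERLAPPING** ([Shewchuk1997] §2.4): the
first component lies 2-below the others, the top two are the one-bit pair `2^a, 2^(a+1)`, and no
component has both its half and its double among the magnitudes. -/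
theorem threeQuarters_isStrongExpansion (j : ℕ) :
    IsStrongExpansion [24 * 2 ^ j - 4, 64 * (2 ^ j * 2 ^ j), 128 * (2 ^ j * 2 ^ j)] := by
  have ht1 : (1 : ℚ) ≤ 2 ^ j := one_le_pow₀ (by norm_num)
  have hjj : (2 : ℚ) ^ j ≤ 2 ^ j * 2 ^ j := by nlinarith
  have h2 : (2 : ℚ) ≠ 0 := by norm_num
  have hz : ∀ k : ℕ, (2 : ℚ) ^ ((j : ℤ) + j + k) = 2 ^ k * (2 ^ j * 2 ^ j) := fun k => by
    rw [zpow_add₀ h2, zpow_add₀ h2, zpow_natCast, zpow_natCast]; ring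
  have e1 : |(24 * 2 ^ j - 4 : ℚ)| = 24 * 2 ^ j - 4 := abs_of_pos (by linarith)
  have e2 : |(64 * (2 ^ j * 2 ^ j) : ℚ)| = 64 * (2 ^ j * 2 ^ j) := abs_of_pos (by positivity)
  have e3 : |(128 * (2 ^ j * 2 ^ j) : ℚ)| = 128 * (2 ^ j * 2 ^ j) := abs_of_pos (by positivity)
  refine ⟨List.Pairwise.cons ?_ (List.Pairwise.cons ?_ (List.pairwise_singleton _ _)), ?_⟩
  · intro y hy
    simp only [List.mem_cons, List.not_mem_nil, or_false] at hy
    rcases hy with rfl | rfl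
    · refine Or.inl ⟨(j : ℤ) + j + (6 : ℕ), ⟨1, by rw [hz]; push_cast; ring⟩, ?_⟩
      rw [e1, hz]; norm_num; linarith
    · refine Or.inl ⟨(j : ℤ) + j + (7 : ℕ), ⟨1, by rw [hz]; push_cast; ring⟩, ?_⟩
      rw [e1, hz]; norm_num; linarith
  · intro y hy
    rw [List.mem_singleton.mp hy]
    refine Or.inr ⟨(j : ℤ) + j + (6 : ℕ), by rw [e2, hz]; norm_num, ?_⟩
    rw [e3, show (j : ℤ) + j + (6 : ℕ) + 1 = (j : ℤ) + j + (7 : ℕ) by push_cast; ring, hz]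
    norm_num
  · intro y hy hy0 h1 h2
    simp only [List.mem_cons, List.not_mem_nil, or_false] at hy
    rcases hy with rfl | rfl | rfl <;>
      simp only [List.map_cons, List.map_nil, e1, e2, e3, List.mem_cons, List.not_mem_nil,
        or_false] at h1 h2
    · rcases h1 with h | h | h <;> linarith
    · rcases h1 with h | h | h <;> nlinarith
    · rcases h2 with h | h | h <;> nlinarith

/-- **`⟨2^p − 1, 2^(2p) + 2^(p+1), 2^(2p+1)⟩` IS NONOVERLAPPING** ([Shewchuk1997] §2.1): `2^p − 1
< 2^(p+1)`, the grid of the word; both lie below `2^(2p+1)` (an adjacent, not one-bit, pair). -/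
theorem threeQuarters_isExpansion (j : ℕ) :
    IsExpansion 1 [8 * 2 ^ j - 1, 64 * (2 ^ j * 2 ^ j) + 16 * 2 ^ j, 128 * (2 ^ j * 2 ^ j)] := by
  have ht1 : (1 : ℚ) ≤ 2 ^ j := one_le_pow₀ (by norm_num)
  have hjj : (2 : ℚ) ^ j ≤ 2 ^ j * 2 ^ j := by nlinarith
  have h2 : (2 : ℚ) ≠ 0 := by norm_num
  have hz7 : (2 : ℚ) ^ ((j : ℤ) + j + (7 : ℕ)) = 2 ^ 7 * (2 ^ j * 2 ^ j) := by
    rw [zpow_add₀ h2, zpow_add₀ h2, zpow_natCast, zpow_natCast]; ring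
  have hz4 : (2 : ℚ) ^ ((j : ℤ) + 4) = 16 * 2 ^ j := by rw [zpow_add₀ h2, zpow_natCast]; ring
  have e1 : |(8 * 2 ^ j - 1 : ℚ)| = 8 * 2 ^ j - 1 := abs_of_pos (by linarith)
  have e2 : |(64 * (2 ^ j * 2 ^ j) + 16 * 2 ^ j : ℚ)| = 64 * (2 ^ j * 2 ^ j) + 16 * 2 ^ j :=
    abs_of_pos (by positivity)
  refine List.Pairwise.cons ?_ (List.pairwise_pair.mpr
    ⟨(j : ℤ) + j + (7 : ℕ), ⟨1, by rw [hz7]; push_cast; ring⟩, by rw [e2, hz7]; linarith⟩)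
  intro y hy
  simp only [List.mem_cons, List.not_mem_nil, or_false] at hy
  rcases hy with rfl | rfl
  · exact ⟨(j : ℤ) + 4, ⟨4 * 2 ^ j + 1, by rw [hz4]; push_cast; ring⟩, by rw [e1, hz4]; linarith⟩
  · exact ⟨(j : ℤ) + j + (7 : ℕ), ⟨1, by rw [hz7]; push_cast; ring⟩, by rw [e1, hz7]; nlinarith⟩

/-- Scale bookkeeping at `p = j + 3`, `s = 2p + 2`: `2^s = 256·2^j·2^j`, `2^(s−p) = 32·2^j`,
`u·2^(s−p) = 4`. -/
theorem threeQuarters_scales (j : ℕ) :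
    (2 : ℚ) ^ (2 * ((j + 3 : ℕ) : ℤ) + 2) = 256 * (2 ^ j * 2 ^ j) ∧
    (2 : ℚ) ^ (2 * ((j + 3 : ℕ) : ℤ) + 2 - ((j + 3 : ℕ) : ℤ)) = 32 * 2 ^ j ∧
    unitRoundoff (j + 3) * (32 * 2 ^ j) = 4 := by
  refine ⟨?_, ?_, by unfold unitRoundoff; field_simp; ring⟩
  · rw [show 2 * ((j + 3 : ℕ) : ℤ) + 2 = ((2 * j + 8 : ℕ) : ℤ) by push_cast; ring, zpow_natCast]
    ring
  · rw [show 2 * ((j + 3 : ℕ) : ℤ) + 2 - ((j + 3 : ℕ) : ℤ) = ((j + 5 : ℕ) : ℤ) by push_cast; ring,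
      zpow_natCast]; ring

/-! ### The families at precision `p` -/

/-- **THE STRONGLY NONOVERLAPPING FAMILY.** For every `p ≥ 3` and `emin ≤ 0`,
`l = ⟨3·2^p − 4, 2^(2p), 2^(2p+1)⟩` is a strongly nonoverlapping expansion of `p`-bit floats with
components `< 2^s`, `s = 2p + 2`, and under round-to-even `estimate l = 3·2^(2p)
= Σ l − (3·2^p − 4)`: the absolute error is `(3/4 − u)·2^(s−p) = (3/4 − u)·u·2^s`,
`u = unitRoundoff p = 2^-p`. -/
theorem estimate_roundTiesEven_strong_family {p : ℕ} (hp : 3 ≤ p) {emin : ℤ} (hemin : emin ≤ 0) :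
    (∀ x ∈ [3 * (2 : ℚ) ^ p - 4, (2 : ℚ) ^ (2 * p), (2 : ℚ) ^ (2 * p + 1)], IsFloat p emin x) ∧
    IsStrongExpansion [3 * (2 : ℚ) ^ p - 4, (2 : ℚ) ^ (2 * p), (2 : ℚ) ^ (2 * p + 1)] ∧
    (∀ x ∈ [3 * (2 : ℚ) ^ p - 4, (2 : ℚ) ^ (2 * p), (2 : ℚ) ^ (2 * p + 1)],
      |x| < (2 : ℚ) ^ (2 * (p : ℤ) + 2)) ∧
    ([3 * (2 : ℚ) ^ p - 4, (2 : ℚ) ^ (2 * p), (2 : ℚ) ^ (2 * p + 1)] : List ℚ).sum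
      = 3 * 2 ^ (2 * p) + 3 * 2 ^ p - 4 ∧
    estimate (roundTiesEven p emin)
      [3 * (2 : ℚ) ^ p - 4, (2 : ℚ) ^ (2 * p), (2 : ℚ) ^ (2 * p + 1)] = 3 * 2 ^ (2 * p) ∧
    |estimate (roundTiesEven p emin)
        [3 * (2 : ℚ) ^ p - 4, (2 : ℚ) ^ (2 * p), (2 : ℚ) ^ (2 * p + 1)]
      - ([3 * (2 : ℚ) ^ p - 4, (2 : ℚ) ^ (2 * p), (2 : ℚ) ^ (2 * p + 1)] : List ℚ).sum|
      = (3 / 4 - unitRoundoff p) * (2 : ℚ) ^ (2 * (p : ℤ) + 2 - p) := by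
  obtain ⟨j, rfl⟩ : ∃ j, p = j + 3 := ⟨p - 3, by omega⟩
  have ht1 : (1 : ℚ) ≤ 2 ^ j := one_le_pow₀ (by norm_num)
  have hjj : (2 : ℚ) ^ j ≤ 2 ^ j * 2 ^ j := by nlinarith
  have e1 : (3 * 2 ^ (j + 3) - 4 : ℚ) = 24 * 2 ^ j - 4 := by ring
  have e2 : (2 : ℚ) ^ (2 * (j + 3)) = 64 * (2 ^ j * 2 ^ j) := by ring
  have e3 : (2 : ℚ) ^ (2 * (j + 3) + 1) = 128 * (2 ^ j * 2 ^ j) := by ring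
  obtain ⟨es, ed, eu⟩ := threeQuarters_scales j
  rw [e1, e2, e3, es, ed,
    (threeQuarters_estimate j hemin (by norm_num : (0 : ℚ) < 4) (by linarith)).1]
  refine ⟨(threeQuarters_isFloat j hemin).1, threeQuarters_isStrongExpansion j, ?_, ?_, by ring, ?_⟩
  · intro x hx
    simp only [List.mem_cons, List.not_mem_nil, or_false] at hx
    rcases hx with rfl | rfl | rfl
    · rw [abs_of_pos (by linarith)]; nlinarith
    · rw [abs_of_pos (by positivity)]; nlinarith
    · rw [abs_of_pos (by positivity)]; nlinarith
  · simp only [List.sum_cons, List.sum_nil]; ring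
  · rw [sub_mul, eu]
    simp only [List.sum_cons, List.sum_nil]
    rw [show (192 * (2 ^ j * 2 ^ j) - (24 * 2 ^ j - 4 + (64 * (2 ^ j * 2 ^ j)
        + (128 * (2 ^ j * 2 ^ j) + 0))) : ℚ) = -(24 * 2 ^ j - 4) by ring, abs_neg,
      abs_of_pos (by linarith)]
    ring

/-- **THE NONOVERLAPPING FAMILY.** For every `p ≥ 3` and `emin ≤ 0`,
`l = ⟨2^p − 1, 2^(2p) + 2^(p+1), 2^(2p+1)⟩` is a nonoverlapping expansion of `p`-bit floats with
components `< 2^s`, `s = 2p + 2`, and under round-to-even `estimate l = 3·2^(2p)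
= Σ l − (3·2^p − 1)`: the absolute error is `(3/4 − u/4)·2^(s−p) = (3/4 − u/4)·u·2^s`. -/
theorem estimate_roundTiesEven_family {p : ℕ} (hp : 3 ≤ p) {emin : ℤ} (hemin : emin ≤ 0) :
    (∀ x ∈ [(2 : ℚ) ^ p - 1, (2 : ℚ) ^ (2 * p) + (2 : ℚ) ^ (p + 1), (2 : ℚ) ^ (2 * p + 1)],
      IsFloat p emin x) ∧
    IsExpansion 1
      [(2 : ℚ) ^ p - 1, (2 : ℚ) ^ (2 * p) + (2 : ℚ) ^ (p + 1), (2 : ℚ) ^ (2 * p + 1)] ∧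
    (∀ x ∈ [(2 : ℚ) ^ p - 1, (2 : ℚ) ^ (2 * p) + (2 : ℚ) ^ (p + 1), (2 : ℚ) ^ (2 * p + 1)],
      |x| < (2 : ℚ) ^ (2 * (p : ℤ) + 2)) ∧
    ([(2 : ℚ) ^ p - 1, (2 : ℚ) ^ (2 * p) + (2 : ℚ) ^ (p + 1), (2 : ℚ) ^ (2 * p + 1)]
        : List ℚ).sum = 3 * 2 ^ (2 * p) + 3 * 2 ^ p - 1 ∧
    estimate (roundTiesEven p emin)
      [(2 : ℚ) ^ p - 1, (2 : ℚ) ^ (2 * p) + (2 : ℚ) ^ (p + 1), (2 : ℚ) ^ (2 * p + 1)]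
      = 3 * 2 ^ (2 * p) ∧
    |estimate (roundTiesEven p emin)
        [(2 : ℚ) ^ p - 1, (2 : ℚ) ^ (2 * p) + (2 : ℚ) ^ (p + 1), (2 : ℚ) ^ (2 * p + 1)]
      - ([(2 : ℚ) ^ p - 1, (2 : ℚ) ^ (2 * p) + (2 : ℚ) ^ (p + 1), (2 : ℚ) ^ (2 * p + 1)]
          : List ℚ).sum|
      = (3 / 4 - unitRoundoff p / 4) * (2 : ℚ) ^ (2 * (p : ℤ) + 2 - p) := by
  obtain ⟨j, rfl⟩ : ∃ j, p = j + 3 := ⟨p - 3, by omega⟩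
  have ht1 : (1 : ℚ) ≤ 2 ^ j := one_le_pow₀ (by norm_num)
  have hjj : (2 : ℚ) ^ j ≤ 2 ^ j * 2 ^ j := by nlinarith
  have e1 : ((2 : ℚ) ^ (j + 3) - 1) = 8 * 2 ^ j - 1 := by ring
  have e2 : (2 : ℚ) ^ (2 * (j + 3)) + (2 : ℚ) ^ (j + 3 + 1)
      = 64 * (2 ^ j * 2 ^ j) + 16 * 2 ^ j := by ring
  have e3 : (2 : ℚ) ^ (2 * (j + 3) + 1) = 128 * (2 ^ j * 2 ^ j) := by ring
  have e4 : (3 * 2 ^ (2 * (j + 3)) : ℚ) = 192 * (2 ^ j * 2 ^ j) := by ring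
  obtain ⟨es, ed, eu⟩ := threeQuarters_scales j
  replace eu : unitRoundoff (j + 3) / 4 * (32 * 2 ^ j) = 1 := by
    rw [div_mul_eq_mul_div, eu]; norm_num
  rw [e1, e2, e3, e4, es, ed,
    (threeQuarters_estimate j hemin (by norm_num : (0 : ℚ) < 1) (by linarith)).2]
  refine ⟨(threeQuarters_isFloat j hemin).2, threeQuarters_isExpansion j, ?_, ?_, rfl, ?_⟩
  · intro x hx
    simp only [List.mem_cons, List.not_mem_nil, or_false] at hx
    rcases hx with rfl | rfl | rfl
    · rw [abs_of_pos (by linarith)]; nlinarith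
    · rw [abs_of_pos (by positivity)]; nlinarith
    · rw [abs_of_pos (by positivity)]; nlinarith
  · simp only [List.sum_cons, List.sum_nil]; ring
  · rw [sub_mul, eu]
    simp only [List.sum_cons, List.sum_nil]
    rw [show (192 * (2 ^ j * 2 ^ j) - (8 * 2 ^ j - 1 + (64 * (2 ^ j * 2 ^ j) + 16 * 2 ^ j
        + (128 * (2 ^ j * 2 ^ j) + 0))) : ℚ) = -(24 * 2 ^ j - 1) by ring, abs_neg,
      abs_of_pos (by linarith)]
    ring

/-- **NO CONSTANT BELOW `3/4` BOUNDS APPROXIMATE'S ERROR UNDER ROUND-TO-EVEN** uniformly in the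
precision — already on three-component strongly nonoverlapping expansions of normal floats
(`emin = 0`): if `|estimate l − Σ l| ≤ c·2^(s−p)` whenever `l` is a strongly nonoverlapping
expansion of floats of `F(p, 0)` with components `< 2^s` (all `p ≥ 3`, all `s`), then `3/4 ≤ c`. -/
theorem three_quarters_le_of_uniform_bound {c : ℚ}
    (h : ∀ (p : ℕ), 3 ≤ p → ∀ (l : List ℚ) (s : ℤ), (∀ x ∈ l, IsFloat p 0 x) →
      IsStrongExpansion l → (∀ x ∈ l, |x| < (2 : ℚ) ^ s) →
        |estimate (roundTiesEven p 0) l - l.sum| ≤ c * (2 : ℚ) ^ (s - p)) :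
    3 / 4 ≤ c := by
  by_contra hc
  rw [not_le] at hc
  -- pick `p = n + 3` with `2^n·(3/4 − c) > 1`; the strong family then errs by more than `c·2^(s−p)`
  obtain ⟨n, hn⟩ := pow_unbounded_of_one_lt (1 / (3 / 4 - c)) (by norm_num : (1 : ℚ) < 2)
  have hpos : (0 : ℚ) < 3 / 4 - c := by linarith
  have hn' : 1 < 2 ^ n * (3 / 4 - c) := by rwa [div_lt_iff₀ hpos] at hn
  obtain ⟨hF, hS, hlt, -, -, habs⟩ :=
    estimate_roundTiesEven_strong_family (p := n + 3) (by omega) (le_refl (0 : ℤ))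
  have := h (n + 3) (by omega) _ _ hF hS hlt
  rw [habs] at this
  obtain ⟨-, ed, eu⟩ := threeQuarters_scales n
  rw [ed, sub_mul, eu] at this
  nlinarith

/-- binary64 (`p = 53`, `emin = −1074`): the three doubles `⟨3·2^53 − 4, 2^106, 2^107⟩` form a
strongly nonoverlapping expansion, and summing them in floating point, smallest first, returns
`3·2^106`: the error `3·2^53 − 4 = (3/4 − 2^-53)·2^55` all but exhausts the bound
`(3/4)·u·2^s = (3/4)·2^55` of the companion file. -/
theorem estimate_roundTiesEven_binary64 :
    (∀ x ∈ [3 * (2 : ℚ) ^ 53 - 4, (2 : ℚ) ^ 106, (2 : ℚ) ^ 107], IsFloat 53 (-1074) x) ∧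
    IsStrongExpansion [3 * (2 : ℚ) ^ 53 - 4, (2 : ℚ) ^ 106, (2 : ℚ) ^ 107] ∧
    estimate (roundTiesEven 53 (-1074)) [3 * (2 : ℚ) ^ 53 - 4, (2 : ℚ) ^ 106, (2 : ℚ) ^ 107]
      = 3 * 2 ^ 106 ∧
    |estimate (roundTiesEven 53 (-1074)) [3 * (2 : ℚ) ^ 53 - 4, (2 : ℚ) ^ 106, (2 : ℚ) ^ 107]
      - ([3 * (2 : ℚ) ^ 53 - 4, (2 : ℚ) ^ 106, (2 : ℚ) ^ 107] : List ℚ).sum|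
      = (3 / 4 - unitRoundoff 53) * (2 : ℚ) ^ (55 : ℤ) := by
  obtain ⟨hF, hS, -, -, hest, habs⟩ :=
    estimate_roundTiesEven_strong_family (p := 53) (by norm_num) (show (-1074 : ℤ) ≤ 0 by norm_num)
  exact ⟨hF, hS, hest, habs⟩

end Summit.Ventures.CertifiedArithmetic.Expansions
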